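import Mathlib
import Summits.Ventures.DiscreteObjects.Mahler.SmythAnalytic
import Summits.Ventures.DiscreteObjects.Mahler.SmythConstant
import Summits.Ventures.DiscreteObjects.Mahler.BlaschkeDataReal
import Summits.Ventures.DiscreteObjects.Mahler.NonreciprocalMeasureBound
import Literature.NumberTheory.MahlerMeasure.NonreciprocalBound

/-!
# Smyth's theorem: nonreciprocal integer polynomials have `M(P) ≥ θ₀ = 1.3247…`
(venture `DiscreteObjects`, target L)

Cell `pub-namedobj`, seat `pub-namedobj-mahler` (gen 8). Framing: lottery ticket; floor = certified
bounds/negative ranges.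

**Theorem** (Smyth 1971; [McKee–Smyth, *Around the Unit Circle*, Thm 12.1]).  If `P ∈ ℤ[X]` has
`P(0) ≠ 0` and is neither reciprocal nor antireciprocal (`P.reverse ≠ ± P`), then
`M(P) ≥ θ₀ = M(z³ - z - 1) = 1.3247…` (`intMahlerMeasure_ge_smythTheta_of_nonreciprocal`).
No irreducibility hypothesis is needed.  As a corollary the Literature named fact
`Literature.NumberTheory.MahlerMeasure.NonreciprocalMahlerBound` (typed statement of Thm 12.1 for
irreducible `P`) is PROVED (`nonreciprocalMahlerBound_holds`), so the census kernel of target L no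
longer depends on it as a hypothesis anywhere.

Proof (kernel files of this seat): integer side `exists_second_nonpalindromic_coeff`
(`εP = P*(1 + aX^k) + bX^ℓ + X^{ℓ+1}R`, `a, b ≠ 0`, `1 ≤ k < ℓ`); complex side
`BlaschkeDataReal.exists_blaschke_data_symm` (Schur functions `f, g`, real coefficients,
`f·P* = εP·g`, `|g(0)| = 1/M`); the coefficient relations `smyth_relations` (Taylor jets,
`TaylorJet*`); the analytic inequality `SmythAnalytic.smyth_analytic` (`c² + c³ ≤ 1` for `c = 1/M`,
from Schwarz–Pick `SchwarzPickHigher`, Parseval `HardyContraction`/`Parseval4` and the endgames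
`SmythArith`); and `SmythConstant` (`M(z³-z-1) = θ₀`, `t³ ≥ t+1 ⇒ t ≥ θ₀`).
-/

namespace Summit.Ventures.DiscreteObjects.Mahler

open Polynomial Metric Set Filter Topology Finset
open scoped ComplexConjugate

noncomputable section

/-! ### Integer side: the first two non-palindromic coefficients -/

/-- For `P` monic with `P(0) = ε = ±1` and `P.reverse ≠ ε P`: there are `1 ≤ k < ℓ`, nonzero integers
`a, b` and `R ∈ ℤ[X]` with `ε P = P.reverse · (1 + a X^k) + b X^ℓ + X^{ℓ+1} R` (the first two
nonzero coefficients `a_k = a`, `a_ℓ = b` of the power series `ε P / P* - 1`). -/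
theorem exists_second_nonpalindromic_coeff {P : ℤ[X]} (hmonic : P.Monic) {ε : ℤ}
    (hε : P.coeff 0 = ε) (hε1 : ε * ε = 1) (hne : P.reverse ≠ C ε * P) :
    ∃ (k ℓ : ℕ) (a b : ℤ) (R : ℤ[X]), 1 ≤ k ∧ k < ℓ ∧ a ≠ 0 ∧ b ≠ 0 ∧
      C ε * P = P.reverse * (1 + C a * X ^ k) + C b * X ^ ℓ + X ^ (ℓ + 1) * R := by
  obtain ⟨k, a, R, hk, ha, hid⟩ := exists_first_nonpalindromic_coeff hmonic hε hε1 hne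
  have hε0 : ε ≠ 0 := by rintro rfl; simp at hε1
  have hP0 : P ≠ 0 := hmonic.ne_zero
  -- `R ≠ 0` by a degree count
  have hR0 : R ≠ 0 := by
    intro hR
    rw [hR, mul_zero, add_zero] at hid
    have h1 : (C ε * P).natDegree = P.natDegree := natDegree_C_mul hε0
    have hrev : P.reverse.natDegree = P.natDegree := by
      rw [reverse_natDegree, natTrailingDegree_eq_zero_of_constantCoeff_ne_zero, Nat.sub_zero]
      rw [constantCoeff_apply, hε]; exact hε0
    have hrev0 : P.reverse ≠ 0 := by
      intro h; exact hP0 (Polynomial.reverse_eq_zero.mp h)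
    have h2 : (1 + C a * X ^ k : ℤ[X]).natDegree = k := by
      rw [add_comm, natDegree_add_eq_left_of_natDegree_lt] <;>
        rw [natDegree_C_mul_X_pow k a ha]
      simp only [natDegree_one]; omega
    have h3 : (P.reverse * (1 + C a * X ^ k)).natDegree = P.natDegree + k := by
      rw [natDegree_mul hrev0, hrev, h2]
      intro h; rw [h, natDegree_zero] at h2; omega
    have := congrArg natDegree hid
    rw [h1, h3] at this
    omega
  -- peel off the lowest term of `R`
  set j := R.natTrailingDegree with hj
  set b := R.coeff j with hb
  have hb0 : b ≠ 0 := by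
    rw [hb, hj]; exact trailingCoeff_eq_zero.not.mpr hR0
  have hdvd : X ^ (j + 1) ∣ R - C b * X ^ j := by
    rw [X_pow_dvd_iff]
    intro d hd
    rw [coeff_sub, coeff_C_mul_X_pow]
    by_cases hdj : d = j
    · subst hdj; simp [hb]
    · rw [if_neg hdj, sub_zero]
      exact coeff_eq_zero_of_lt_natTrailingDegree (by omega)
  obtain ⟨R', hR'⟩ := hdvd
  refine ⟨k, k + 1 + j, a, b, R', hk, by omega, ha, hb0, ?_⟩
  have hR : R = C b * X ^ j + X ^ (j + 1) * R' := by rw [← hR']; ring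
  rw [hid, hR]
  ring

/-! ### Complex side: the coefficient relations -/

/-- **The nonreciprocity relations.**  If `P` is monic, `ε P = P* (1 + a X^k) + b X^ℓ + X^{ℓ+1} R`
over `ℤ`, and `f, g` are holomorphic on the unit disc with `f · P* = ε · P · g` there, then for
`n ≤ ℓ` the Taylor coefficients satisfy `fₙ = gₙ + a g_{n-k} [k ≤ n] + b g(0) [n = ℓ]`. -/
theorem smyth_relations {P : ℤ[X]} (hmonic : P.Monic) {ε : ℤ} {k ℓ : ℕ} {a b : ℤ} {R : ℤ[X]}
    (hid : C ε * P = P.reverse * (1 + C a * X ^ k) + C b * X ^ ℓ + X ^ (ℓ + 1) * R)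
    {f g : ℂ → ℂ} (hf : DifferentiableOn ℂ f (ball 0 1)) (hg : DifferentiableOn ℂ g (ball 0 1))
    (hfg : ∀ z ∈ ball (0 : ℂ) 1, f z * (P.reverse.map (Int.castRingHom ℂ)).eval z =
      (ε : ℂ) * (P.map (Int.castRingHom ℂ)).eval z * g z) :
    ∀ n, n ≤ ℓ → jetCoeff f n = jetCoeff g n + (if k ≤ n then (a : ℂ) * jetCoeff g (n - k) else 0) +
      (if n = ℓ then (b : ℂ) * g 0 else 0) := by
  set Pc := P.map (Int.castRingHom ℂ)
  set Prc := P.reverse.map (Int.castRingHom ℂ) with hPrc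
  set Rc := R.map (Int.castRingHom ℂ)
  have hidC : ∀ w : ℂ, (ε : ℂ) * Pc.eval w =
      Prc.eval w * (1 + (a : ℂ) * w ^ k) + (b : ℂ) * w ^ ℓ + w ^ (ℓ + 1) * Rc.eval w := by
    intro w
    have h := congrArg (fun Q : ℤ[X] => (Q.map (Int.castRingHom ℂ)).eval w) hid
    simpa [Polynomial.map_mul, Polynomial.map_add, Polynomial.map_pow, eval_mul, eval_add,
      eval_pow] using h
  -- a disc `ball 0 r` on which `P*` does not vanish
  have hPrc0 : Prc.eval 0 = 1 := by
    rw [← coeff_zero_eq_eval_zero, hPrc, coeff_map, coeff_zero_reverse, hmonic.leadingCoeff]; simp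
  obtain ⟨r, hr0, hr1, hPr⟩ : ∃ r : ℝ, 0 < r ∧ r ≤ 1 ∧ ∀ w ∈ ball (0 : ℂ) r, Prc.eval w ≠ 0 := by
    have hc : ContinuousAt (fun w => Prc.eval w) 0 := (Polynomial.continuous Prc).continuousAt
    have hne : ∀ᶠ w in 𝓝 (0 : ℂ), Prc.eval w ≠ 0 := by
      apply hc.eventually_ne; rw [hPrc0]; exact one_ne_zero
    obtain ⟨r, hr0, hr⟩ := Metric.eventually_nhds_iff_ball.mp hne
    exact ⟨min r 1, lt_min hr0 one_pos, min_le_right _ _,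
      fun w hw => hr w (ball_subset_ball (min_le_left _ _) hw)⟩
  have hsub : ball (0 : ℂ) r ⊆ ball 0 1 := ball_subset_ball hr1
  have hgr : DifferentiableOn ℂ g (ball 0 r) := hg.mono hsub
  have hfr : DifferentiableOn ℂ f (ball 0 r) := hf.mono hsub
  -- `h = g / P*` and `E = R h`
  set h : ℂ → ℂ := fun w => g w / Prc.eval w with hh
  have hhd : DifferentiableOn ℂ h (ball 0 r) :=
    hgr.div (Polynomial.differentiable Prc).differentiableOn hPr
  set E : ℂ → ℂ := fun w => Rc.eval w * h w with hE
  have hEd : DifferentiableOn ℂ E (ball 0 r) := (Polynomial.differentiable Rc).differentiableOn.mul hhd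
  -- the pointwise identity on the small disc
  have hpt : ∀ w ∈ ball (0 : ℂ) r, f w =
      g w + (a : ℂ) * (w ^ k * g w) + (b : ℂ) * (w ^ ℓ * h w) + w ^ (ℓ + 1) * E w := by
    intro w hw
    have h1 := hfg w (hsub hw)
    have h2 := hidC w
    have h3 := hPr w hw
    simp only [hE, hh]
    field_simp
    linear_combination h1 + g w * h2
  -- Taylor coefficients of the right-hand side
  have hd1 : DifferentiableOn ℂ (fun w => w ^ k * g w) (ball 0 r) := (differentiableOn_id.pow k).mul hgr
  have hd2 : DifferentiableOn ℂ (fun w => w ^ ℓ * h w) (ball 0 r) := (differentiableOn_id.pow ℓ).mul hhd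
  have hd3 : DifferentiableOn ℂ (fun w => w ^ (ℓ + 1) * E w) (ball 0 r) :=
    (differentiableOn_id.pow (ℓ + 1)).mul hEd
  have dA : DifferentiableOn ℂ (fun w => g w + (a : ℂ) * (w ^ k * g w)) (ball 0 r) :=
    hgr.add (hd1.const_mul _)
  have dB : DifferentiableOn ℂ (fun w => (b : ℂ) * (w ^ ℓ * h w)) (ball 0 r) := hd2.const_mul _
  have dAB : DifferentiableOn ℂ (fun w => g w + (a : ℂ) * (w ^ k * g w) + (b : ℂ) * (w ^ ℓ * h w))
      (ball 0 r) := dA.add dB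
  have dABC : DifferentiableOn ℂ
      (fun w => g w + (a : ℂ) * (w ^ k * g w) + (b : ℂ) * (w ^ ℓ * h w) + w ^ (ℓ + 1) * E w)
      (ball 0 r) := dAB.add hd3
  intro n hn
  rw [jetCoeff_congr hr0 dABC hpt n, jetCoeff_add hr0 dAB hd3, jetCoeff_add hr0 dA dB,
    jetCoeff_add hr0 hgr (hd1.const_mul _), jetCoeff_const_mul hr0 hd1, jetCoeff_const_mul hr0 hd2,
    jetCoeff_pow_mul' hr0 hgr, jetCoeff_pow_mul' hr0 hhd, jetCoeff_pow_mul' hr0 hEd,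
    if_neg (by omega : ¬ ℓ + 1 ≤ n), add_zero]
  have e2 : (a : ℂ) * (if k ≤ n then jetCoeff g (n - k) else 0) =
      if k ≤ n then (a : ℂ) * jetCoeff g (n - k) else 0 := by
    split_ifs <;> simp
  have e3 : (b : ℂ) * (if ℓ ≤ n then jetCoeff h (n - ℓ) else 0) =
      if n = ℓ then (b : ℂ) * g 0 else 0 := by
    by_cases hnl : n = ℓ
    · subst hnl
      rw [if_pos le_rfl, if_pos rfl, Nat.sub_self, jetCoeff_zero]
      simp [hh, hPrc0]
    · rw [if_neg (by omega), if_neg hnl, mul_zero]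
  rw [e2, e3]

/-! ### The theorem -/

/-- Core case: `P` monic, `P(0) = ε = ±1`, `P.reverse ≠ ε P` ⟹ `M(P) ≥ θ₀`. -/
theorem smythTheta_le_of_monic {P : ℤ[X]} (hmonic : P.Monic) {ε : ℤ} (hε : P.coeff 0 = ε)
    (hε1 : ε * ε = 1) (hne : P.reverse ≠ C ε * P) (hM1 : 1 < intMahlerMeasure P) :
    smythTheta ≤ intMahlerMeasure P := by
  obtain ⟨k, ℓ, a, b, R, hk, hkl, ha, hb, hid⟩ := exists_second_nonpalindromic_coeff hmonic hε hε1 hne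
  obtain ⟨f₀, g₀, hf₀d, hg₀d, hf₀b, hg₀b, hfg₀, hg₀0, hfg₀0, hf₀s, hg₀s⟩ :=
    exists_blaschke_data_symm hmonic hε hε1
  set M := intMahlerMeasure P
  have hMpos : 0 < M := lt_trans one_pos hM1
  -- `g₀ 0` is real of modulus `1/M`; normalise its sign
  have hg₀real : ((g₀ 0).re : ℂ) = g₀ 0 := by
    apply Complex.conj_eq_iff_re.mp
    have := hg₀s 0
    rw [map_zero] at this
    exact this.symm
  set σ : ℝ := if 0 ≤ (g₀ 0).re then 1 else -1 with hσ
  have hσabs : |σ| = 1 := by rw [hσ]; split_ifs <;> norm_num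
  set c : ℝ := σ * (g₀ 0).re with hcdef
  have hcabs : c = |(g₀ 0).re| := by
    rw [hcdef, hσ]; split_ifs with h
    · rw [one_mul, abs_of_nonneg h]
    · push Not at h; rw [abs_of_neg h]; ring
  have hnorm : ‖g₀ 0‖ = |(g₀ 0).re| := by
    conv_lhs => rw [← hg₀real]
    rw [Complex.norm_real, Real.norm_eq_abs]
  have hcM : c = M⁻¹ := by rw [hcabs, ← hnorm, hg₀0]
  have hcpos : 0 < c := by rw [hcM]; positivity
  have hclt : c < 1 := by rw [hcM]; exact inv_lt_one_of_one_lt₀ hM1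
  -- the normalised pair
  set f : ℂ → ℂ := fun z => (σ : ℂ) * f₀ z
  set g : ℂ → ℂ := fun z => (σ : ℂ) * g₀ z
  have hfd : DifferentiableOn ℂ f (ball 0 1) := hf₀d.const_mul _
  have hgd : DifferentiableOn ℂ g (ball 0 1) := hg₀d.const_mul _
  have hσn : ‖(σ : ℂ)‖ = 1 := by rw [Complex.norm_real, Real.norm_eq_abs, hσabs]
  have hfS : IsSchur f := ⟨hfd, fun z hz => by
    show ‖(σ : ℂ) * f₀ z‖ ≤ 1
    rw [norm_mul, hσn, one_mul]; exact hf₀b z hz⟩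
  have hgS : IsSchur g := ⟨hgd, fun z hz => by
    show ‖(σ : ℂ) * g₀ z‖ ≤ 1
    rw [norm_mul, hσn, one_mul]; exact hg₀b z hz⟩
  have hfsym : ∀ z, f (conj z) = conj (f z) := fun z => by
    show (σ : ℂ) * f₀ (conj z) = conj ((σ : ℂ) * f₀ z)
    rw [map_mul, Complex.conj_ofReal, hf₀s]
  have hgsym : ∀ z, g (conj z) = conj (g z) := fun z => by
    show (σ : ℂ) * g₀ (conj z) = conj ((σ : ℂ) * g₀ z)
    rw [map_mul, Complex.conj_ofReal, hg₀s]
  have hfg : ∀ z ∈ ball (0 : ℂ) 1, f z * (P.reverse.map (Int.castRingHom ℂ)).eval z =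
      (ε : ℂ) * (P.map (Int.castRingHom ℂ)).eval z * g z := by
    intro z hz
    show (σ : ℂ) * f₀ z * _ = (ε : ℂ) * _ * ((σ : ℂ) * g₀ z)
    rw [mul_assoc, hfg₀ z hz]; ring
  have hg0 : jetCoeff g 0 = c := by
    rw [jetCoeff_zero]
    show (σ : ℂ) * g₀ 0 = ((σ * (g₀ 0).re : ℝ) : ℂ)
    conv_lhs => rw [← hg₀real]
    push_cast; ring
  have hf0 : jetCoeff f 0 = c := by
    rw [jetCoeff_zero]
    show (σ : ℂ) * f₀ 0 = ((σ * (g₀ 0).re : ℝ) : ℂ)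
    rw [hfg₀0]
    conv_lhs => rw [← hg₀real]
    push_cast; ring
  have D : SmythData f g c :=
    ⟨hfS, hgS, jetCoeff_conj_of_symm one_pos hfd hfsym, jetCoeff_conj_of_symm one_pos hgd hgsym,
      hf0, hg0, hcpos, hclt⟩
  -- the relations, real parts
  have hrelC := smyth_relations hmonic hid hfd hgd hfg
  have hg0' : g 0 = (c : ℂ) := by rw [← hg0, jetCoeff_zero]
  have hrel : ∀ n, n ≤ ℓ → (jetCoeff f n).re = (jetCoeff g n).re +
      (if k ≤ n then (a : ℝ) * (jetCoeff g (n - k)).re else 0) +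
      (if n = ℓ then (b : ℝ) * c else 0) := by
    intro n hn
    have h := congrArg Complex.re (hrelC n hn)
    rw [hg0'] at h
    rw [h, Complex.add_re, Complex.add_re]
    congr 2
    · split_ifs
      · rw [show ((a : ℤ) : ℂ) = ((a : ℝ) : ℂ) by norm_cast, Complex.re_ofReal_mul]
      · simp
    · split_ifs
      · rw [show ((b : ℤ) : ℂ) = ((b : ℝ) : ℂ) by norm_cast, Complex.re_ofReal_mul, Complex.ofReal_re]
      · simp
  have key := smyth_analytic D hk hkl ha hb hrel
  -- `c² + c³ ≤ 1` with `c = 1/M` gives `M ≥ θ₀`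
  rw [hcM] at key
  exact smythTheta_le_of_inv hMpos key

/-- **Smyth's theorem** (Smyth 1971; [McKee–Smyth, Thm 12.1]).  An integer polynomial with
`P(0) ≠ 0` which is neither reciprocal nor antireciprocal has Mahler measure `≥ θ₀ = 1.3247…`
(the real root of `t³ = t + 1`, `= M(z³ - z - 1)`).  No irreducibility is assumed. -/
theorem intMahlerMeasure_ge_smythTheta_of_nonreciprocal {P : ℤ[X]} (h0 : P.coeff 0 ≠ 0)
    (h1 : P.reverse ≠ P) (h2 : P.reverse ≠ -P) : smythTheta ≤ intMahlerMeasure P := by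
  have hP0 : P ≠ 0 := fun h => h0 (by simp [h])
  have hθ2 : smythTheta ≤ 2 := le_trans smythTheta_lt.le (by norm_num)
  -- leading coefficient `± 1`, else `M ≥ 2`
  by_cases hlc : 2 ≤ |P.leadingCoeff|
  · have h := abs_leadingCoeff_le_intMahlerMeasure P
    have : (2 : ℝ) ≤ |(P.leadingCoeff : ℝ)| := by exact_mod_cast hlc
    linarith
  have hlc1 : |P.leadingCoeff| = 1 := by
    have hne : P.leadingCoeff ≠ 0 := leadingCoeff_ne_zero.mpr hP0
    have := Int.one_le_abs hne
    omega
  -- reduce to the monic case via `P ↦ -P`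
  obtain ⟨Q, hQm, hQM, hQ0, hQ1, hQ2⟩ : ∃ Q : ℤ[X], Q.Monic ∧ intMahlerMeasure Q = intMahlerMeasure P ∧
      Q.coeff 0 ≠ 0 ∧ Q.reverse ≠ Q ∧ Q.reverse ≠ -Q := by
    rcases (abs_eq (zero_le_one' ℤ)).mp hlc1 with h | h
    · exact ⟨P, h, rfl, h0, h1, h2⟩
    · refine ⟨-P, ?_, intMahlerMeasure_neg P, by simpa using h0, ?_, ?_⟩
      · rw [Monic, leadingCoeff_neg, h, neg_neg]
      · rw [reverse_neg]; intro h'; exact h1 (neg_injective h')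
      · rw [reverse_neg, neg_neg]; intro h'; exact h2 (by rw [← neg_neg P.reverse, h'])
  rw [← hQM]
  -- constant coefficient `± 1`, else `M ≥ 2`
  by_cases hc : 2 ≤ |Q.coeff 0|
  · have h := abs_coeff_zero_le_intMahlerMeasure hQm
    have : (2 : ℝ) ≤ |(Q.coeff 0 : ℝ)| := by exact_mod_cast hc
    linarith
  have hc1 : |Q.coeff 0| = 1 := by
    have := Int.one_le_abs hQ0
    omega
  set ε := Q.coeff 0 with hεdef
  have hε1 : ε * ε = 1 := by
    rcases (abs_eq (zero_le_one' ℤ)).mp hc1 with h | h <;> simp [h]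
  have hne : Q.reverse ≠ C ε * Q := by
    rcases (abs_eq (zero_le_one' ℤ)).mp hc1 with h | h
    · rw [h, C_1, one_mul]; exact hQ1
    · rw [h, C_neg, C_1, neg_one_mul]; exact hQ2
  -- `M(Q) > 1` (indeed `≥ 1.28` by the gen-7 bound)
  have hM1 : 1 < intMahlerMeasure Q := lt_trans (by norm_num) (intMahlerMeasure_gt_of_nonreciprocal hQ0 hQ1 hQ2)
  exact smythTheta_le_of_monic hQm rfl hε1 hne hM1

/-- Numerical form: a nonreciprocal integer polynomial with `P(0) ≠ 0` has `M(P) > 1.3247`. -/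
theorem intMahlerMeasure_gt_13247_of_nonreciprocal {P : ℤ[X]} (h0 : P.coeff 0 ≠ 0)
    (h1 : P.reverse ≠ P) (h2 : P.reverse ≠ -P) : (13247 : ℝ) / 10000 < intMahlerMeasure P :=
  lt_of_lt_of_le smythTheta_gt (intMahlerMeasure_ge_smythTheta_of_nonreciprocal h0 h1 h2)

/-- `M(z³ - z - 1) ≤ M(P)` for every nonreciprocal `P ∈ ℤ[X]` with `P(0) ≠ 0`. -/
theorem mahlerMeasure_X_cube_sub_X_sub_one_le_of_nonreciprocal {P : ℤ[X]} (h0 : P.coeff 0 ≠ 0)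
    (h1 : P.reverse ≠ P) (h2 : P.reverse ≠ -P) :
    ((X ^ 3 - X - 1 : ℤ[X]).map (Int.castRingHom ℂ)).mahlerMeasure ≤
      (P.map (Int.castRingHom ℂ)).mahlerMeasure := by
  rw [mahlerMeasure_map_X_cube_sub_X_sub_one]
  exact intMahlerMeasure_ge_smythTheta_of_nonreciprocal h0 h1 h2

/-- **The Literature named fact `NonreciprocalMahlerBound` ([McKee–Smyth, Thm 12.1]) holds.** -/
theorem nonreciprocalMahlerBound_holds : Literature.NumberTheory.MahlerMeasure.NonreciprocalMahlerBound :=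
  fun _ _ h0 h1 h2 => mahlerMeasure_X_cube_sub_X_sub_one_le_of_nonreciprocal h0 h1 h2

end

end Summit.Ventures.DiscreteObjects.Mahler
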